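import Summits.BirchSwinnertonDyer.BirchSwinnertonDyer.Theorems.SignedLowerHalvesKobayashiLowerHalfLargeImageLambdaTwoStratumMainConjecture
import HarnessLib

/-!
# Route `SignedLowerHalves`, crux 3 `KobayashiLowerHalfLargeImage` (item stmt-BirchSwinnertonDyer-19001):
# the `λ = 2` STRATUM, part 3 — the two branches joined, the Eisenstein half
# `KobayashiLowerDivisibility W p ε`, the X7 readings in the crux's shape `∃ ε, KobayashiLowerDivisibility W p ε`,
# and the residue NAMED (cell `bsd-ssimc`, width seat `bsd-line-slh-p1-w2` gen 6; helper file
# `--supports 19001`; executes §4 of `Cruxes/KobayashiLowerHalfLargeImage/K1G17-SEARCH-LOG.md`)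

HONEST FRAMING: the crux is OPEN and nothing here proves it for the class; BSD is not proved by any
of this. CONDITIONAL theorems on the DISPLAYED binders of parts 1–2 (`h12`, `h41`, `h5`, `h3`, `hL20`,
`hK08`, `hK13`, `hpar`, `hFE` — all PUBLISHED named facts / tree theorems) and ONE per-pair
certificate `(μ, λ)(L_p^ε) = (0, 2)` plus ONE residual bit. CALIBRATION / SUPPORT ONLY (pen rule
D34-4 (3)): never an input to a registered stub, never a `closes`, never a by-name close of the item.

## What this file does

* `kobayashiMainConjecture_of_lam_eq_two_of_imp` — **on the `λ = 2` stratum (`p ≥ 5`, `a_p = 0`,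
  `ρ̄` onto) the main conjecture for the sign `ε` holds UNLESS `Sel_{p^∞}(E/ℚ)` is finite with
  `p ∤ ∏ c_ℓ · #Sel_{p^∞}(E/ℚ)`**: `corank = 0` ⇒ `Sel_{p^∞}(E/ℚ)` finite (it is `p`-primary and
  cofinitely generated: `finite_torsionBy_selmerGroupPInfty`, `finite_of_zpCorank_eq_zero`) ⇒ part 2
  §4; `corank ≠ 0` ⇒ part 2 §3.
* `kobayashiLowerDivisibility_of_lam_eq_two_of_selmerCorank_ne_zero`, `…_of_imp` — the Eisenstein
  half (the crux's currency) in both forms.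
* `kobayashiMainConjecture_{neg_one,one}_of_mazurTate_lam_two_of_{imp,selmerCorank_ne_zero}` — the
  certificate as ONE Mazur–Tate element `Θ` (`ι Θ = θ_n(f₀)`, `μ(Θ) = 0`, `λ(Θ) = deg ω_n^± + 2 < pⁿ`;
  bridge `lam_signed_{neg_one,one}_eq_of_mazurTate`, Pollack Prop. 6.9/6.10): the records-level form.
* `X7.exists_kobayashiLowerDivisibility_of_lam_eq_two_of_selmerCorank_ne_zero`, `X7.…_of_imp` —
  crux 3's conclusion `∃ ε, KobayashiLowerDivisibility W p ε` at an X7 pair on the stratum, with the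
  crux's binders displayed verbatim (`¬ W.HasCM` unused).

WHAT IS LEFT on the stratum (named, not attacked): the pairs with `Sel_{p^∞}(E/ℚ)` finite,
`p ∤ #Sel_{p^∞}(E/ℚ)` (so `Ш(E/ℚ)[p] = 0`) and `p ∤ Tam(E)`, where the certificate says `L_p^ε` has
two zeros in the open disc (`p ∣ L(E,1)/Ω_E`) and the conjecture predicts such pairs do not exist — the
one-element rank-`0` converse «`p ∣ L(E,1)/Ω_E ⇒ p ∣ #Ш(E)·Tam(E)`» (K1G17 §4 (b); Kurihara's
`δ̃_1 = L^{alg}(E,1) mod p` row of the line of record). At `p = 3` the finite-Selmer branch is not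
available (Kim 2008 is `p > 3`), so there the residue also contains the `3 ∣ Tam` rows.

References: [Kobayashi2003] Thm. 1.2, Thm. 4.1, Conjecture (p. 2); [KimBD2008MRL] Thm. 3.12;
[BDKim2013] Cor. 3.15; [DokchitserDokchitserAnnals2010] Thm. 1.4; [Sprung2017] Cor. 4.14;
[Greenberg1999LNM] §1 pp. 54–57. Crux dir: `K1G17-SEARCH-LOG.md` §4.
-/

set_option autoImplicit false
set_option linter.dupNamespace false

noncomputable section

open scoped Classical MatrixGroups ModularForm

open CongruenceSubgroup PowerSeries WeierstrassCurve Literature.NumberTheory.EllipticCurves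
  Literature.NumberTheory.EllipticCurves.ModularForms Literature.Barriers.BirchSwinnertonDyer
  Literature.NumberTheory.EllipticCurves.Rank1Residual Literature.NumberTheory.EllipticCurves.Sprung2017
  Literature.NumberTheory.EllipticCurves.Kobayashi2003 ZpExtension
  Literature.NumberTheory.EllipticCurves.Rank1Residual.Typed
  Summit.BirchSwinnertonDyer.Rank1Residual Summit.BirchSwinnertonDyer.Rank1Residual.X1.MuLambda
  Summit.BirchSwinnertonDyer.Rank1Residual.Supersingular
  Summit.BirchSwinnertonDyer.BirchSwinnertonDyer.Theorems.LargeImageParityStratum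

namespace Summit.BirchSwinnertonDyer.BirchSwinnertonDyer.Theorems.LargeImageLambdaTwoStratum

/-! ## §5. The two branches together; the Eisenstein half; the X7 readings; the residue named -/

section Readings

variable (W : WeierstrassCurve ℚ) [W.IsElliptic] [W.IsGloballyMinimal] (p : ℕ) [Fact p.Prime]

/-- **On the `λ = 2` stratum the main conjecture holds UNLESS `Sel_{p^∞}(E/ℚ)` is finite with
`p ∤ ∏ c_ℓ · #Sel_{p^∞}(E/ℚ)`.** `p ≥ 5` good, `a_p = 0`, `ρ̄` onto, certificate `(μ, λ)(L_p^ε) = (0, 2)`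
for the newform of level `N_E`, all binders of §§3–4 (`h12`, `h41`, `h5`, `h3`, `hL20`, `hK08`, `hK13`,
`hpar`, `hFE`), and the ONE residual hypothesis `hres`: IF `Sel_{p^∞}(E/ℚ)` is finite THEN
`p ∣ ∏ c_ℓ · #Sel_{p^∞}(E/ℚ)`. Proof: `corank = 0` ⇒ `Sel_{p^∞}` finite (cofinitely generated:
`finite_torsionBy_selmerGroupPInfty`, `finite_of_zpCorank_eq_zero`) ⇒ §4; `corank ≠ 0` ⇒ §3 (parity).
WHAT IS LEFT on the stratum is therefore exactly the pairs with `Sel_{p^∞}(E/ℚ)` finite,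
`p ∤ #Sel_{p^∞}(E/ℚ)` (so `Ш(E/ℚ)[p] = 0`) and `p ∤ Tam(E)` — where the certificate says
`L_p^ε ∈ (p, T)²`-shape vanishing and the conjecture predicts such pairs do not exist (the one-element
converse `p ∣ L(E,1)/Ω_E ⇒ p ∣ #Ш(E)·Tam(E)`, K1G17 §4 (b)); not attacked here.
[cite: Kobayashi2003, Thm. 1.2, Thm. 4.1 and Conjecture (p. 2)] [cite: KimBD2008MRL, Thm. 3.12 (p. 93)]
[cite: BDKim2013, Cor. 3.15 (p. 199)] [cite: DokchitserDokchitserAnnals2010, Thm. 1.4]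
[cite: Sprung2017, Cor. 4.14 (a_p = 0 display)] [cite: Greenberg1999LNM, §1 pp. 54–57] -/
theorem kobayashiMainConjecture_of_lam_eq_two_of_imp
    (h12 : Kobayashi2003.thm12_signedSelmerDual_finite_torsion)
    (h41 : Kobayashi2003.thm41_signedCharIdeal_divisibility)
    (h5 : realPeriodRat_eq_unit_mul_plusPeriod) (h3 : realPeriodRat_eq_unit_mul_plusPeriod_three)
    (hL20 : Wuthrich2014.lemma20_surjective_threeAdic_of_semistable)
    (hK08 : Kim2008.thm312_signedSelmerDual_charIdeal_map_invol)
    (hK13 : BDKim2013.cor315_signedCharValue_rankZero)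
    (hpar : p_parity W p) (hFE : Sprung2017.cor414_sharpFlat_functionalEquation_apZero)
    (hp5 : 5 ≤ p) (hgood : W.HasGoodReductionAtPrime p) (hap : W.frobeniusTrace p = 0)
    (hs : Surj W p) (ε : ℤˣ)
    [NeZero (W.conductorNorm ℤ)] {f₀ : CuspForm (Gamma0 (W.conductorNorm ℤ)) 2} (hf₀ : IsNewformOf W f₀)
    (hcert₀ : ∀ L : IwasawaAlgebra p, IsSignedPAdicLFunction f₀ p ε L → mu L = 0 ∧ lam L = 2)
    (hres : Finite (W.selmerGroupPInfty p) → p ∣ W.tamagawaProduct * Nat.card (W.selmerGroupPInfty p)) :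
    KobayashiMainConjecture W p ε := by
  have hp : p ≠ 2 := by omega
  by_cases h0 : W.selmerCorank p = 0
  · -- corank `0`: the `p`-primary, cofinitely generated Selmer group is finite
    have hfin : Finite (W.selmerGroupPInfty p) := by
      have hprim : ∀ x : W.selmerGroupPInfty p, ∃ k : ℕ, p ^ k • x = 0 := fun x ↦ by
        obtain ⟨k, hk⟩ := exists_pow_nsmul_eq_zero_galH1Primary W p (x : galH1Primary W p)
        exact ⟨k, Subtype.ext (by rw [AddSubmonoidClass.coe_nsmul, hk, ZeroMemClass.coe_zero])⟩
      haveI : Finite (AddSubgroup.torsionBy (W.selmerGroupPInfty p) (p : ℤ)) :=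
        W.finite_torsionBy_selmerGroupPInfty
      exact finite_of_zpCorank_eq_zero p hprim h0
    exact kobayashiMainConjecture_of_lam_eq_two_of_finite_of_dvd W p h12 h41 h5 h3 hL20 hK08 hK13 hp5
      hgood hap hs ε hf₀ hcert₀ hfin (hres hfin)
  · exact kobayashiMainConjecture_of_lam_eq_two_of_selmerCorank_ne_zero W p h12 h41 h5 h3 hL20 hpar hFE
      hp hgood hap hs ε hf₀ hcert₀ h0

/-- **The Eisenstein half `KobayashiLowerDivisibility W p ε` on the `λ = 2` stratum, branch «corank»**
(any odd `p`; binders of §3). [cite: Kobayashi2003, Conjecture (Main Conjecture) (p. 2)] -/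
theorem kobayashiLowerDivisibility_of_lam_eq_two_of_selmerCorank_ne_zero
    (h12 : Kobayashi2003.thm12_signedSelmerDual_finite_torsion)
    (h41 : Kobayashi2003.thm41_signedCharIdeal_divisibility)
    (h5 : realPeriodRat_eq_unit_mul_plusPeriod) (h3 : realPeriodRat_eq_unit_mul_plusPeriod_three)
    (hL20 : Wuthrich2014.lemma20_surjective_threeAdic_of_semistable)
    (hpar : p_parity W p) (hFE : Sprung2017.cor414_sharpFlat_functionalEquation_apZero)
    (hp : p ≠ 2) (hgood : W.HasGoodReductionAtPrime p) (hap : W.frobeniusTrace p = 0)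
    (hs : Surj W p) (ε : ℤˣ)
    [NeZero (W.conductorNorm ℤ)] {f₀ : CuspForm (Gamma0 (W.conductorNorm ℤ)) 2} (hf₀ : IsNewformOf W f₀)
    (hcert₀ : ∀ L : IwasawaAlgebra p, IsSignedPAdicLFunction f₀ p ε L → mu L = 0 ∧ lam L = 2)
    (hcork : W.selmerCorank p ≠ 0) :
    KobayashiLowerDivisibility W p ε :=
  kobayashiLowerDivisibility_of_mainConjecture
    (kobayashiMainConjecture_of_lam_eq_two_of_selmerCorank_ne_zero W p h12 h41 h5 h3 hL20 hpar hFE hp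
      hgood hap hs ε hf₀ hcert₀ hcork)

/-- **The Eisenstein half `KobayashiLowerDivisibility W p ε` on the `λ = 2` stratum, both branches**
(`p ≥ 5`; binders of §§3–4 and the residual hypothesis `hres`). [cite: Kobayashi2003, Conjecture (Main Conjecture) (p. 2)] -/
theorem kobayashiLowerDivisibility_of_lam_eq_two_of_imp
    (h12 : Kobayashi2003.thm12_signedSelmerDual_finite_torsion)
    (h41 : Kobayashi2003.thm41_signedCharIdeal_divisibility)
    (h5 : realPeriodRat_eq_unit_mul_plusPeriod) (h3 : realPeriodRat_eq_unit_mul_plusPeriod_three)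
    (hL20 : Wuthrich2014.lemma20_surjective_threeAdic_of_semistable)
    (hK08 : Kim2008.thm312_signedSelmerDual_charIdeal_map_invol)
    (hK13 : BDKim2013.cor315_signedCharValue_rankZero)
    (hpar : p_parity W p) (hFE : Sprung2017.cor414_sharpFlat_functionalEquation_apZero)
    (hp5 : 5 ≤ p) (hgood : W.HasGoodReductionAtPrime p) (hap : W.frobeniusTrace p = 0)
    (hs : Surj W p) (ε : ℤˣ)
    [NeZero (W.conductorNorm ℤ)] {f₀ : CuspForm (Gamma0 (W.conductorNorm ℤ)) 2} (hf₀ : IsNewformOf W f₀)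
    (hcert₀ : ∀ L : IwasawaAlgebra p, IsSignedPAdicLFunction f₀ p ε L → mu L = 0 ∧ lam L = 2)
    (hres : Finite (W.selmerGroupPInfty p) → p ∣ W.tamagawaProduct * Nat.card (W.selmerGroupPInfty p)) :
    KobayashiLowerDivisibility W p ε :=
  kobayashiLowerDivisibility_of_mainConjecture
    (kobayashiMainConjecture_of_lam_eq_two_of_imp W p h12 h41 h5 h3 hL20 hK08 hK13 hpar hFE hp5 hgood hap
      hs ε hf₀ hcert₀ hres)

/-- **Crux 3's conclusion `∃ ε, KobayashiLowerDivisibility W p ε` at an X7 pair ON THE `λ = 2` STRATUM,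
branch «corank»**: odd `p`, `ClassX7 W p` (good supersingular, `E` not semistable), `a_p = 0`,
`Surj W p`, and for SOME sign `ε` the certificate `(μ, λ)(L_p^ε) = (0, 2)` at the newform of level
`N_E` plus `corank Sel_{p^∞}(E/ℚ) ≠ 0`. The crux's binder `¬ W.HasCM` is NOT used (displayed with `_`
to match the crux verbatim). What it says about item 19001: the class-wide statement holds on the
sub-population «one signed `p`-adic `L`-function has `(μ, λ) = (0, 2)` and `E(ℚ)` or `Ш[p^∞]` is
infinite» (e.g. the rank-`2` rows with a sharp certificate).
[cite: Kobayashi2003, Thm. 1.2, Thm. 4.1 and Conjecture (p. 2)] [cite: DokchitserDokchitserAnnals2010, Thm. 1.4]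
[cite: Sprung2017, Cor. 4.14 (a_p = 0 display)] [cite: Wuthrich2014, Lemma 20 (p. 399)] -/
theorem X7.exists_kobayashiLowerDivisibility_of_lam_eq_two_of_selmerCorank_ne_zero
    (h12 : Kobayashi2003.thm12_signedSelmerDual_finite_torsion)
    (h41 : Kobayashi2003.thm41_signedCharIdeal_divisibility)
    (h5 : realPeriodRat_eq_unit_mul_plusPeriod) (h3 : realPeriodRat_eq_unit_mul_plusPeriod_three)
    (hL20 : Wuthrich2014.lemma20_surjective_threeAdic_of_semistable)
    (hpar : p_parity W p) (hFE : Sprung2017.cor414_sharpFlat_functionalEquation_apZero)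
    (hp : p ≠ 2) (hX : ClassX7 W p) (_hCM : ¬ W.HasCM) (hap : W.frobeniusTrace p = 0) (hs : Surj W p)
    [NeZero (W.conductorNorm ℤ)] {f₀ : CuspForm (Gamma0 (W.conductorNorm ℤ)) 2} (hf₀ : IsNewformOf W f₀)
    {ε : ℤˣ} (hcert₀ : ∀ L : IwasawaAlgebra p, IsSignedPAdicLFunction f₀ p ε L → mu L = 0 ∧ lam L = 2)
    (hcork : W.selmerCorank p ≠ 0) :
    ∃ ε : ℤˣ, KobayashiLowerDivisibility W p ε :=
  ⟨ε, kobayashiLowerDivisibility_of_lam_eq_two_of_selmerCorank_ne_zero W p h12 h41 h5 h3 hL20 hpar hFE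
    hp hX.1.1 hap hs ε hf₀ hcert₀ hcork⟩

/-- **Crux 3's conclusion `∃ ε, KobayashiLowerDivisibility W p ε` at an X7 pair ON THE `λ = 2` STRATUM,
both branches** (`p ≥ 5`): `ClassX7 W p`, `a_p = 0`, `Surj W p`, for SOME sign `ε` the certificate
`(μ, λ)(L_p^ε) = (0, 2)` at the newform of level `N_E`, and the residual bit `hres` (if
`Sel_{p^∞}(E/ℚ)` is finite then `p ∣ Tam(E) · #Sel_{p^∞}(E/ℚ)`). `¬ W.HasCM` unused. What it says
about item 19001 at `p ≥ 5`: on the `λ = 2` stratum the crux is OPEN only at the pairs with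
`Sel_{p^∞}(E/ℚ) = 0`-up-to-`p` and `p ∤ Tam(E)` — the one-element rank-`0` converse (K1G17 §4 (b)).
[cite: Kobayashi2003, Thm. 1.2, Thm. 4.1 and Conjecture (p. 2)] [cite: KimBD2008MRL, Thm. 3.12 (p. 93)]
[cite: BDKim2013, Cor. 3.15 (p. 199)] [cite: DokchitserDokchitserAnnals2010, Thm. 1.4]
[cite: Sprung2017, Cor. 4.14 (a_p = 0 display)] -/
theorem X7.exists_kobayashiLowerDivisibility_of_lam_eq_two_of_imp
    (h12 : Kobayashi2003.thm12_signedSelmerDual_finite_torsion)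
    (h41 : Kobayashi2003.thm41_signedCharIdeal_divisibility)
    (h5 : realPeriodRat_eq_unit_mul_plusPeriod) (h3 : realPeriodRat_eq_unit_mul_plusPeriod_three)
    (hL20 : Wuthrich2014.lemma20_surjective_threeAdic_of_semistable)
    (hK08 : Kim2008.thm312_signedSelmerDual_charIdeal_map_invol)
    (hK13 : BDKim2013.cor315_signedCharValue_rankZero)
    (hpar : p_parity W p) (hFE : Sprung2017.cor414_sharpFlat_functionalEquation_apZero)
    (hp5 : 5 ≤ p) (hX : ClassX7 W p) (_hCM : ¬ W.HasCM) (hap : W.frobeniusTrace p = 0) (hs : Surj W p)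
    [NeZero (W.conductorNorm ℤ)] {f₀ : CuspForm (Gamma0 (W.conductorNorm ℤ)) 2} (hf₀ : IsNewformOf W f₀)
    {ε : ℤˣ} (hcert₀ : ∀ L : IwasawaAlgebra p, IsSignedPAdicLFunction f₀ p ε L → mu L = 0 ∧ lam L = 2)
    (hres : Finite (W.selmerGroupPInfty p) → p ∣ W.tamagawaProduct * Nat.card (W.selmerGroupPInfty p)) :
    ∃ ε : ℤˣ, KobayashiLowerDivisibility W p ε :=
  ⟨ε, kobayashiLowerDivisibility_of_lam_eq_two_of_imp W p h12 h41 h5 h3 hL20 hK08 hK13 hpar hFE hp5 hX.1.1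
    hap hs ε hf₀ hcert₀ hres⟩


/-! ### The certificate as ONE Mazur–Tate element (`λ(θ_n) = deg ω_n^± + 2`) -/

/-- **Kobayashi's main conjecture for `(E, p, −1)` (Kobayashi's `L_p^-` = the tree's `L⁺`, ODD levels)
on the `λ = 2` stratum, from ONE odd-level Mazur–Tate element**: `p ≥ 5` good, `a_p = 0`, `ρ̄` onto,
the binders of parts 1–2, a non-zero `Θ ∈ Λ` with `ι Θ = θ_n(f₀)`, `n` odd, `μ(Θ) = 0`,
`λ(Θ) = deg ω_n^+ + 2 < pⁿ` (then `(μ, λ)(L_p^-) = (0, 2)`, `lam_signed_neg_one_eq_of_mazurTate`,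
Pollack Prop. 6.9/6.10), and the residual bit `hres`. The records-level form of this file: per pair ONE
`p`-integral polynomial and ONE divisibility `p ∣ Tam(E)·#Sel_{p^∞}(E/ℚ)` (needed only when
`Sel_{p^∞}(E/ℚ)` is finite). [cite: Kobayashi2003, Thm. 1.2, Thm. 4.1 and Conjecture (p. 2)]
[cite: Pollack2003, Prop. 6.9, 6.10 and 6.18] [cite: KimBD2008MRL, Thm. 3.12 (p. 93)] [cite: BDKim2013, Cor. 3.15 (p. 199)] -/
theorem kobayashiMainConjecture_neg_one_of_mazurTate_lam_two_of_imp
    (h12 : Kobayashi2003.thm12_signedSelmerDual_finite_torsion)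
    (h41 : Kobayashi2003.thm41_signedCharIdeal_divisibility)
    (h5 : realPeriodRat_eq_unit_mul_plusPeriod) (h3 : realPeriodRat_eq_unit_mul_plusPeriod_three)
    (hL20 : Wuthrich2014.lemma20_surjective_threeAdic_of_semistable)
    (hK08 : Kim2008.thm312_signedSelmerDual_charIdeal_map_invol)
    (hK13 : BDKim2013.cor315_signedCharValue_rankZero)
    (hpar : p_parity W p) (hFE : Sprung2017.cor414_sharpFlat_functionalEquation_apZero)
    (hp5 : 5 ≤ p) (hgood : W.HasGoodReductionAtPrime p) (hap : W.frobeniusTrace p = 0) (hs : Surj W p)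
    [NeZero (W.conductorNorm ℤ)] {f₀ : CuspForm (Gamma0 (W.conductorNorm ℤ)) 2} (hf₀ : IsNewformOf W f₀)
    {n : ℕ} (hn : Odd n) {Θ : IwasawaAlgebra p}
    (hΘ : iwasawaToPowerSeries p Θ =
      ((mazurTateElement f₀ p n).map (algebraMap ℚ ℚ_[p]) : PowerSeries ℚ_[p]))
    (hΘ0 : Θ ≠ 0) (hμ : mu Θ = 0)
    (hlam : lam Θ = (cyclotomicOmegaPlus p n).natDegree + 2) (hlt : lam Θ < p ^ n)
    (hres : Finite (W.selmerGroupPInfty p) → p ∣ W.tamagawaProduct * Nat.card (W.selmerGroupPInfty p)) :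
    KobayashiMainConjecture W p (-1) :=
  kobayashiMainConjecture_of_lam_eq_two_of_imp W p h12 h41 h5 h3 hL20 hK08 hK13 hpar hFE hp5 hgood hap hs
    (-1) hf₀ (fun _ hL ↦ lam_signed_neg_one_eq_of_mazurTate (by omega) hf₀ hgood hap hL hn hΘ hΘ0 hμ hlam hlt)
    hres

/-- **The same for `(E, p, 1)` (Kobayashi's `L_p^+` = the tree's `L⁻`, EVEN levels)**: `n` even,
`λ(Θ) = deg ω_n^- + 2 < pⁿ`. [cite: Kobayashi2003, Thm. 1.2, Thm. 4.1 and Conjecture (p. 2)]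
[cite: Pollack2003, Prop. 6.9, 6.10 and 6.18] [cite: KimBD2008MRL, Thm. 3.12 (p. 93)] [cite: BDKim2013, Cor. 3.15 (p. 199)] -/
theorem kobayashiMainConjecture_one_of_mazurTate_lam_two_of_imp
    (h12 : Kobayashi2003.thm12_signedSelmerDual_finite_torsion)
    (h41 : Kobayashi2003.thm41_signedCharIdeal_divisibility)
    (h5 : realPeriodRat_eq_unit_mul_plusPeriod) (h3 : realPeriodRat_eq_unit_mul_plusPeriod_three)
    (hL20 : Wuthrich2014.lemma20_surjective_threeAdic_of_semistable)
    (hK08 : Kim2008.thm312_signedSelmerDual_charIdeal_map_invol)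
    (hK13 : BDKim2013.cor315_signedCharValue_rankZero)
    (hpar : p_parity W p) (hFE : Sprung2017.cor414_sharpFlat_functionalEquation_apZero)
    (hp5 : 5 ≤ p) (hgood : W.HasGoodReductionAtPrime p) (hap : W.frobeniusTrace p = 0) (hs : Surj W p)
    [NeZero (W.conductorNorm ℤ)] {f₀ : CuspForm (Gamma0 (W.conductorNorm ℤ)) 2} (hf₀ : IsNewformOf W f₀)
    {n : ℕ} (hn : Even n) {Θ : IwasawaAlgebra p}
    (hΘ : iwasawaToPowerSeries p Θ =
      ((mazurTateElement f₀ p n).map (algebraMap ℚ ℚ_[p]) : PowerSeries ℚ_[p]))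
    (hΘ0 : Θ ≠ 0) (hμ : mu Θ = 0)
    (hlam : lam Θ = (cyclotomicOmegaMinus p n).natDegree + 2) (hlt : lam Θ < p ^ n)
    (hres : Finite (W.selmerGroupPInfty p) → p ∣ W.tamagawaProduct * Nat.card (W.selmerGroupPInfty p)) :
    KobayashiMainConjecture W p 1 :=
  kobayashiMainConjecture_of_lam_eq_two_of_imp W p h12 h41 h5 h3 hL20 hK08 hK13 hpar hFE hp5 hgood hap hs
    1 hf₀ (fun _ hL ↦ lam_signed_one_eq_of_mazurTate (by omega) hf₀ hgood hap hL hn hΘ hΘ0 hμ hlam hlt)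
    hres

/-- **Branch «corank» from ONE odd-level Mazur–Tate element, any odd `p`** (no `hK08`/`hK13`): `Θ` as
above with `λ(Θ) = deg ω_n^+ + 2`, and `corank_{ℤ_p} Sel_{p^∞}(E/ℚ) ≠ 0` ⇒ the main conjecture for
`(E, p, −1)`. [cite: Kobayashi2003, Thm. 1.2, Thm. 4.1 and Conjecture (p. 2)] [cite: Pollack2003, Prop. 6.9, 6.10 and 6.18]
[cite: DokchitserDokchitserAnnals2010, Thm. 1.4] [cite: Sprung2017, Cor. 4.14 (a_p = 0 display)] -/
theorem kobayashiMainConjecture_neg_one_of_mazurTate_lam_two_of_selmerCorank_ne_zero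
    (h12 : Kobayashi2003.thm12_signedSelmerDual_finite_torsion)
    (h41 : Kobayashi2003.thm41_signedCharIdeal_divisibility)
    (h5 : realPeriodRat_eq_unit_mul_plusPeriod) (h3 : realPeriodRat_eq_unit_mul_plusPeriod_three)
    (hL20 : Wuthrich2014.lemma20_surjective_threeAdic_of_semistable)
    (hpar : p_parity W p) (hFE : Sprung2017.cor414_sharpFlat_functionalEquation_apZero)
    (hp : p ≠ 2) (hgood : W.HasGoodReductionAtPrime p) (hap : W.frobeniusTrace p = 0) (hs : Surj W p)
    [NeZero (W.conductorNorm ℤ)] {f₀ : CuspForm (Gamma0 (W.conductorNorm ℤ)) 2} (hf₀ : IsNewformOf W f₀)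
    {n : ℕ} (hn : Odd n) {Θ : IwasawaAlgebra p}
    (hΘ : iwasawaToPowerSeries p Θ =
      ((mazurTateElement f₀ p n).map (algebraMap ℚ ℚ_[p]) : PowerSeries ℚ_[p]))
    (hΘ0 : Θ ≠ 0) (hμ : mu Θ = 0)
    (hlam : lam Θ = (cyclotomicOmegaPlus p n).natDegree + 2) (hlt : lam Θ < p ^ n)
    (hcork : W.selmerCorank p ≠ 0) :
    KobayashiMainConjecture W p (-1) :=
  kobayashiMainConjecture_of_lam_eq_two_of_selmerCorank_ne_zero W p h12 h41 h5 h3 hL20 hpar hFE hp hgood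
    hap hs (-1) hf₀
    (fun _ hL ↦ lam_signed_neg_one_eq_of_mazurTate hp hf₀ hgood hap hL hn hΘ hΘ0 hμ hlam hlt) hcork

/-- **Branch «corank» from ONE even-level Mazur–Tate element, any odd `p`**: `n` even,
`λ(Θ) = deg ω_n^- + 2`, `corank ≠ 0` ⇒ the main conjecture for `(E, p, 1)`.
[cite: Kobayashi2003, Thm. 1.2, Thm. 4.1 and Conjecture (p. 2)] [cite: Pollack2003, Prop. 6.9, 6.10 and 6.18]
[cite: DokchitserDokchitserAnnals2010, Thm. 1.4] [cite: Sprung2017, Cor. 4.14 (a_p = 0 display)] -/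
theorem kobayashiMainConjecture_one_of_mazurTate_lam_two_of_selmerCorank_ne_zero
    (h12 : Kobayashi2003.thm12_signedSelmerDual_finite_torsion)
    (h41 : Kobayashi2003.thm41_signedCharIdeal_divisibility)
    (h5 : realPeriodRat_eq_unit_mul_plusPeriod) (h3 : realPeriodRat_eq_unit_mul_plusPeriod_three)
    (hL20 : Wuthrich2014.lemma20_surjective_threeAdic_of_semistable)
    (hpar : p_parity W p) (hFE : Sprung2017.cor414_sharpFlat_functionalEquation_apZero)
    (hp : p ≠ 2) (hgood : W.HasGoodReductionAtPrime p) (hap : W.frobeniusTrace p = 0) (hs : Surj W p)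
    [NeZero (W.conductorNorm ℤ)] {f₀ : CuspForm (Gamma0 (W.conductorNorm ℤ)) 2} (hf₀ : IsNewformOf W f₀)
    {n : ℕ} (hn : Even n) {Θ : IwasawaAlgebra p}
    (hΘ : iwasawaToPowerSeries p Θ =
      ((mazurTateElement f₀ p n).map (algebraMap ℚ ℚ_[p]) : PowerSeries ℚ_[p]))
    (hΘ0 : Θ ≠ 0) (hμ : mu Θ = 0)
    (hlam : lam Θ = (cyclotomicOmegaMinus p n).natDegree + 2) (hlt : lam Θ < p ^ n)
    (hcork : W.selmerCorank p ≠ 0) :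
    KobayashiMainConjecture W p 1 :=
  kobayashiMainConjecture_of_lam_eq_two_of_selmerCorank_ne_zero W p h12 h41 h5 h3 hL20 hpar hFE hp hgood
    hap hs 1 hf₀
    (fun _ hL ↦ lam_signed_one_eq_of_mazurTate hp hf₀ hgood hap hL hn hΘ hΘ0 hμ hlam hlt) hcork

end Readings

end Summit.BirchSwinnertonDyer.BirchSwinnertonDyer.Theorems.LargeImageLambdaTwoStratum

end
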